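import Literature.MathematicalPhysics.QuantumFieldTheory.BalabanImbrieJaffe1984to88.BIJ88Ineq547W1Prime

/-!
# `BalabanImbrieJaffe1984to88.BIJ88W5Bound549` — T. Bałaban, J. Imbrie, A. Jaffe, *Effective action and cluster properties of the abelian
Higgs model*, Commun. Math. Phys. **114** (1988) 257–315 [BalabanImbrieJaffe1988]: p. 283, the kernel `w₅` of (5.4.9) *"is another small,
exponentially decaying kernel"* — PROVED as a model instance on r16's ring-level `BIJ88Sect5StatementsPart3.w5` in the kernel ring
`Matrix ι ι ℝ`, in the shape `|w₅(b,b′)| ≤ e^{−cr(e_k)}e^{−c dist(b,b′)}` that p. 290 quotes and p36's (5.7.6) instance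
`BIJ88Ineq576Proof.ineq576_Zd` consumes, from the p. 282 tail bound of `BIJ88Ineq547W1Prime` and (2.7)

statement-level skeleton of published theorems with citation tags; proofs where landed; nothing here is a claim about the Yang–Mills mass gap

PDF held: `paper:balaban1988-cmp114-bij-abelian-higgs-effective-action` (journal page = PDF page + 256); p. 283 [PDF 27] read this session as
text and as an image rendered from the held PDF (seat folder `renders/bij88-p027.png`); p. 290 as quoted in `BIJ88Ineq576Proof`.

WHAT IS REPRODUCED.  SKELETON row **C2.Eq5.4.8-5.4.10**, the sentence after (5.4.9) (owner r16: *"(5.4.9) `eq549` proved with the CORRECTED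
sign (𝒟_k−𝒟_{k,loc}); printed sign refuted `eq549_asPrinted_false`"*; the smallness sentence was not typed) — cell `lit-balaban`, HOME
`run/shared/lean/pub/lit-balaban/`; Phase-2 seat p08 gen 4 = unit `lit-balaban-p08` (third file of the generation, after `BIJ88MultiscaleDecay223`
p249538 and `BIJ88Ineq547W1Prime`); referee ref-5.  p. 283 [PDF 27], verbatim: *"We put Λ̄₂^{(k)*}(Q^{s*}_k − 𝒟_{k,loc}∂*Q^{e*}_k∂)A′ = … +
H_{k,loc}Λ₃^{(k)*}A′ + ∂C_kΛ₃^{(k)*}A′ + w₅A′. (5.4.9) Here w₅ = [(𝒟_{k,loc} − 𝒟_k)∂*Q^{e*}_k∂ + H_k − H_{k,loc}]Λ₃^{(k)*} is another small,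
exponentially decaying kernel. … The term w₅A′ will be removed later on; it couples A′ to bonds everywhere in T_η."*  p. 290 [PDF 34] (as
quoted by p36): *"|A′(b_l)| ≤ cp(e_k), |w₅(b,b_l)| ≤ e^{−cr(e_k)}e^{−c dist(b,b_l)} and so |w_{b,m}(X)| ≤ e^{−cr(e_k)|X|}. (5.7.6)"*.

WHAT IS PROVED HERE (0 `sorry`, standard axioms; kind «model instance / hence-step»; the sign of the tail is immaterial for the bound).
`w5_apply` (entry formula: with `Λ₃^{(k)*} = diagonal χ₃`, `w₅(x,b) = ((𝒟_k − 𝒟_{k,loc})X + H_k − H_{k,loc})(x,b)·χ₃(b)`, `X = ∂*Q^{e*}_k∂`);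
**`abs_w5_le`** (two explicit constants: the tail bound of p. 282 for `(𝒟_k − 𝒟_{k,loc})(x,y)` (`BIJ88Ineq547W1Prime.abs_tailSum_le` shape,
`F·e^{−δ dist₂(x,y)}`, `F = B·e^{−cr(e_k)}`), the local factor `X` (column-ℓ¹ `≤ q`, range glue ρ: `BIJ88Ineq547W1Prime.abs_mul_localRight_le`),
(2.7) `|H_{k,loc} − H_k| ≤ εe^{−c₇ dist}` (r18's `Close`) and `|χ₃| ≤ 1` give `|w₅(x,b)| ≤ Fqe^{δρ}e^{−δ dist(x,b)} + εe^{−c₇ dist(x,b)}` for ALL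
`(x,b)` — no column restriction, `Λ₃^{(k)*}` acting on the right); **`ineq547_w5`** = the one-letter shape
`BIJ88Sect5StatementsPart2.Ineq547 ι ι w₅ dist c″ r(e_k)` (= p. 290's `|w₅(b,b_l)| ≤ e^{−cr(e_k)}e^{−c dist(b,b_l)}`, the hypothesis `hw` of p36's
`BIJ88Ineq576Proof` at c₁ = c₂ = c″) once the prefactor is absorbed («e_k small»: `(Fqe^{δρ} + ε) ≤ e^{−c″r(e_k)}` with `F, ε` carrying
`e^{−cr(e_k)}`) and `c″ ≤ min(δ, c₇)`.
HONEST SCOPE.  As in `BIJ88Ineq547W1Prime`: the per-scale estimates behind the tail bound, the locality of `∂*Q^{e*}_k∂`, (2.7), and the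
absorption of O(1) prefactors are displayed hypotheses; nothing on d = 4 or the continuum; NOT summit progress.
-/

namespace Literature.MathematicalPhysics.QuantumFieldTheory.BalabanImbrieJaffe1984to88.BIJ88W5Bound549

open Finset Matrix BIJ88Sect2Statements BIJ88Ineq547W1Prime
open BIJ88Sect5StatementsPart2 (Ineq547)
open BIJ88Sect5StatementsPart3 (w5)

noncomputable section

variable {ι : Type} [Fintype ι] [DecidableEq ι]

/-- Entry formula of r16's `w₅ = [(𝒟_k − 𝒟_{k,loc})∂*Q^{e*}_k∂ + H_k − H_{k,loc}]Λ₃^{(k)*}` (corrected sign) in `Matrix ι ι ℝ` with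
`Λ₃^{(k)*} = diagonal χ₃`: `w₅(x,b) = (Σ_y(𝒟_k − 𝒟_{k,loc})(x,y)X(y,b) + (H_k − H_{k,loc})(x,b))·χ₃(b)`, `X = ∂*Q^{e*}_k∂`.
[cite: BalabanImbrieJaffe1988, (5.4.9) p.283] -/
theorem w5_apply (Dk Dloc ds Qes d Hk Hloc : Matrix ι ι ℝ) (χ₃ : ι → ℝ) (x b : ι) :
    w5 Dk Dloc ds Qes d Hk Hloc (diagonal χ₃) x b
      = ((∑ y, (Dk - Dloc) x y * (ds * Qes * d) y b) + (Hk x b - Hloc x b)) * χ₃ b := by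
  show (((Dk - Dloc) * ds * Qes * d + Hk - Hloc) * diagonal χ₃) x b = _
  rw [Matrix.mul_diagonal, Matrix.sub_apply, Matrix.add_apply]
  simp only [Matrix.mul_assoc]
  rw [Matrix.mul_apply]
  ring

/-- **`w₅` "is another small, exponentially decaying kernel" — two explicit constants.**  With the p. 282 tail bound
`|(𝒟_k − 𝒟_{k,loc})(x,y)| ≤ F·e^{−δ dist₂(x,y)}`, a local factor `X = ∂*Q^{e*}_k∂` (columns of ℓ¹-norm `≤ q`, `X(y,b) ≠ 0 ⟹ dist(x,b) ≤ dist₂(x,y) + ρ`),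
(2.7) `|H_{k,loc} − H_k|(x,b) ≤ εe^{−c₇ dist(x,b)}` and `|χ₃| ≤ 1`: `|w₅(x,b)| ≤ Fqe^{δρ}·e^{−δ dist(x,b)} + ε·e^{−c₇ dist(x,b)}` for all `x, b`.
[cite: BalabanImbrieJaffe1988, (5.4.9) p.283] -/
theorem abs_w5_le (Dk Dloc ds Qes d Hk Hloc : Matrix ι ι ℝ) (χ₃ : ι → ℝ) {dist₂ dist : ι → ι → ℝ} {F δ q ρ ε c₇ : ℝ}
    (hF : 0 ≤ F) (hδ : 0 ≤ δ) (htail : ∀ x y, |(Dk - Dloc) x y| ≤ F * Real.exp (-(δ * dist₂ x y)))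
    (hXcol : ∀ b, ∑ y, |(ds * Qes * d) y b| ≤ q) (hXglue : ∀ x y b, (ds * Qes * d) y b ≠ 0 → dist x b ≤ dist₂ x y + ρ)
    (h27 : Close dist Hloc Hk ε c₇) (hχ : ∀ b, |χ₃ b| ≤ 1) (x b : ι) :
    |w5 Dk Dloc ds Qes d Hk Hloc (diagonal χ₃) x b|
      ≤ F * q * Real.exp (δ * ρ) * Real.exp (-(δ * dist x b)) + ε * Real.exp (-c₇ * dist x b) := by
  rw [w5_apply, abs_mul]
  have h1 := abs_mul_localRight_le hF hδ htail hXcol hXglue x b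
  have h2 : |Hk x b - Hloc x b| ≤ ε * Real.exp (-c₇ * dist x b) := by rw [abs_sub_comm]; exact h27 x b
  have hsum : |(∑ y, (Dk - Dloc) x y * (ds * Qes * d) y b) + (Hk x b - Hloc x b)|
      ≤ F * q * Real.exp (δ * ρ) * Real.exp (-(δ * dist x b)) + ε * Real.exp (-c₇ * dist x b) :=
    (abs_add_le _ _).trans (add_le_add h1 h2)
  have hnn : 0 ≤ F * q * Real.exp (δ * ρ) * Real.exp (-(δ * dist x b)) + ε * Real.exp (-c₇ * dist x b) :=
    (abs_nonneg _).trans hsum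
  calc _ ≤ (F * q * Real.exp (δ * ρ) * Real.exp (-(δ * dist x b)) + ε * Real.exp (-c₇ * dist x b)) * 1 :=
        mul_le_mul hsum (hχ b) (abs_nonneg _) hnn
    _ = _ := mul_one _

/-- **THE QUOTED SHAPE** (p. 290: `|w₅(b,b_l)| ≤ e^{−cr(e_k)}e^{−c dist(b,b_l)}`, the hypothesis of p36's `BIJ88Ineq576Proof` instances; r16's
one-letter `Ineq547 ι ι w₅ dist c″ r(e_k)`): from `abs_w5_le` once the prefactors are absorbed into `e^{−c″r(e_k)}` («e_k small»: with
`F = B·e^{−cr(e_k)}` and `ε = e^{−c₇r(e_k)}` this is `Bqe^{δρ}e^{−cr(e_k)} + e^{−c₇r(e_k)} ≤ e^{−c″r(e_k)}`) and `c″ ≤ min(δ, c₇)` (nonnegative `dist`).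
[cite: BalabanImbrieJaffe1988, (5.4.9) p.283] -/
theorem ineq547_w5 (Dk Dloc ds Qes d Hk Hloc : Matrix ι ι ℝ) (χ₃ : ι → ℝ) {dist₂ dist : ι → ι → ℝ}
    {F δ q ρ ε c₇ c'' rk : ℝ} (hF : 0 ≤ F) (hδ : 0 ≤ δ) (hε : 0 ≤ ε) (hd : ∀ x b, 0 ≤ dist x b)
    (htail : ∀ x y, |(Dk - Dloc) x y| ≤ F * Real.exp (-(δ * dist₂ x y)))
    (hXcol : ∀ b, ∑ y, |(ds * Qes * d) y b| ≤ q) (hXglue : ∀ x y b, (ds * Qes * d) y b ≠ 0 → dist x b ≤ dist₂ x y + ρ)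
    (h27 : Close dist Hloc Hk ε c₇) (hχ : ∀ b, |χ₃ b| ≤ 1)
    (habs : F * q * Real.exp (δ * ρ) + ε ≤ Real.exp (-(c'' * rk))) (hcδ : c'' ≤ δ) (hc₇ : c'' ≤ c₇) :
    Ineq547 ι ι (fun x b => w5 Dk Dloc ds Qes d Hk Hloc (diagonal χ₃) x b) dist c'' rk := by
  intro x b
  dsimp only
  refine (abs_w5_le Dk Dloc ds Qes d Hk Hloc χ₃ hF hδ htail hXcol hXglue h27 hχ x b).trans ?_
  have hdx := hd x b
  have e1 : Real.exp (-(δ * dist x b)) ≤ Real.exp (-(c'' * dist x b)) :=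
    Real.exp_le_exp.2 (neg_le_neg (mul_le_mul_of_nonneg_right hcδ hdx))
  have e2 : Real.exp (-c₇ * dist x b) ≤ Real.exp (-(c'' * dist x b)) := by
    rw [neg_mul]; exact Real.exp_le_exp.2 (neg_le_neg (mul_le_mul_of_nonneg_right hc₇ hdx))
  have hq : 0 ≤ F * q * Real.exp (δ * ρ) := by
    have hq0 : 0 ≤ q := le_trans (Finset.sum_nonneg fun y _ => abs_nonneg _) (hXcol b)
    positivity
  calc F * q * Real.exp (δ * ρ) * Real.exp (-(δ * dist x b)) + ε * Real.exp (-c₇ * dist x b)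
      ≤ F * q * Real.exp (δ * ρ) * Real.exp (-(c'' * dist x b)) + ε * Real.exp (-(c'' * dist x b)) :=
        add_le_add (mul_le_mul_of_nonneg_left e1 hq) (mul_le_mul_of_nonneg_left e2 hε)
    _ = (F * q * Real.exp (δ * ρ) + ε) * Real.exp (-(c'' * dist x b)) := by ring
    _ ≤ Real.exp (-(c'' * rk)) * Real.exp (-(c'' * dist x b)) :=
        mul_le_mul_of_nonneg_right habs (Real.exp_pos _).le

/-- The same bound for the kernel WITH THE PRINTED SIGN `(𝒟_{k,loc} − 𝒟_k)` of p. 283 (r16's `eq549_asPrinted_false` concerns the identity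
(5.4.9), not the size): the tail hypothesis is symmetric under `Dk ↔ Dloc`, so `Ineq547` holds verbatim for `w5 Dloc Dk …` too.
[cite: BalabanImbrieJaffe1988, (5.4.9) p.283] -/
theorem ineq547_w5_printedSign (Dk Dloc ds Qes d Hk Hloc : Matrix ι ι ℝ) (χ₃ : ι → ℝ) {dist₂ dist : ι → ι → ℝ}
    {F δ q ρ ε c₇ c'' rk : ℝ} (hF : 0 ≤ F) (hδ : 0 ≤ δ) (hε : 0 ≤ ε) (hd : ∀ x b, 0 ≤ dist x b)
    (htail : ∀ x y, |(Dk - Dloc) x y| ≤ F * Real.exp (-(δ * dist₂ x y)))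
    (hXcol : ∀ b, ∑ y, |(ds * Qes * d) y b| ≤ q) (hXglue : ∀ x y b, (ds * Qes * d) y b ≠ 0 → dist x b ≤ dist₂ x y + ρ)
    (h27 : Close dist Hloc Hk ε c₇) (hχ : ∀ b, |χ₃ b| ≤ 1)
    (habs : F * q * Real.exp (δ * ρ) + ε ≤ Real.exp (-(c'' * rk))) (hcδ : c'' ≤ δ) (hc₇ : c'' ≤ c₇) :
    Ineq547 ι ι (fun x b => w5 Dloc Dk ds Qes d Hk Hloc (diagonal χ₃) x b) dist c'' rk := by
  have htail' : ∀ x y, |(Dloc - Dk) x y| ≤ F * Real.exp (-(δ * dist₂ x y)) := by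
    intro x y
    rw [Matrix.sub_apply, abs_sub_comm, ← Matrix.sub_apply]
    exact htail x y
  exact ineq547_w5 Dloc Dk ds Qes d Hk Hloc χ₃ hF hδ hε hd htail' hXcol hXglue h27 hχ habs hcδ hc₇

end

end Literature.MathematicalPhysics.QuantumFieldTheory.BalabanImbrieJaffe1984to88.BIJ88W5Bound549
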